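import Summits.BirchSwinnertonDyer.BirchSwinnertonDyer.Theorems.ResidualThetaTransportAtTwoThetaLayerLambdaCongruenceAtTwoCuspSpanQuadratic
import HarnessLib

/-!
# Route `ResidualThetaTransportAtTwo`, cruxes Kan⁺ (stmt-BirchSwinnertonDyer-20688) / 21437: the quadratic-`ψ` assembly in
# CERTIFICATE form (element-keyed dispatch lemmas for the generated files `…CuspSpanCertQ*.lean`)

Cell `bsd-wall`, lead prover `bsd-wall-rtt-p3` g9 (2026-08-28). THEOREMS ONLY; `--supports stmt-BirchSwinnertonDyer-20688`; BSD is
not proved by this. `cuspSpanTrace_of_quadratic_certificate'` restates `cuspSpanTrace_of_quadratic_certificate` with the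
hypothesis keyed by a `b = −1` ELEMENT `β` (as the per-residue case split of the certificate files produces it), and
`quad_inl` / `quad_inr` are the two one-step dispatch terms (`K(r)` with `r^{(p−1)/2} = 1`, resp. `E(r, r₀)` with
`r^{(p−1)/2} = −1`).

References: [Pollack2003] Conj. 6.3; [Rademacher1929] §1; Mathlib `ZMod.euler_criterion`.
-/

set_option autoImplicit false
set_option linter.dupNamespace false

open scoped MatrixGroups

open CongruenceSubgroup

namespace Summit.BirchSwinnertonDyer.BirchSwinnertonDyer.Theorems.SignedMuAtTwo

variable {p : ℕ} [Fact p.Prime] {χ : Gamma0 p → ZMod 2}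

/-- Dispatch term, square branch: from `d(β) ≡ r`, `r^{(p−1)/2} = 1` and `K(r)`. [folklore] -/
theorem quad_inl {r₀ : ZMod p} {β : Gamma0 p} (hb : (β : SL(2, ℤ)) 0 1 = -1) {r : ZMod p}
    (h : ((((β : SL(2, ℤ)) 1 1 : ℤ) : ZMod p)) = r) (h1 : r ^ (p / 2) = 1)
    (hK : ∀ β : Gamma0 p, (β : SL(2, ℤ)) 0 1 = -1 → ((((β : SL(2, ℤ)) 1 1 : ℤ) : ZMod p)) = r → χ β = 0) :
    (((((β : SL(2, ℤ)) 1 1 : ℤ) : ZMod p)) ^ (p / 2) = 1 ∧ χ β = 0) ∨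
    (((((β : SL(2, ℤ)) 1 1 : ℤ) : ZMod p)) ^ (p / 2) = -1 ∧ ∀ β' : Gamma0 p, (β' : SL(2, ℤ)) 0 1 = -1 →
      ((((β' : SL(2, ℤ)) 1 1 : ℤ) : ZMod p)) = r₀ → χ β = χ β') :=
  Or.inl ⟨by rw [h, h1], hK β hb h⟩

/-- Dispatch term, non-square branch: from `d(β) ≡ r`, `r^{(p−1)/2} = −1` and `E(r, r₀)`. [folklore] -/
theorem quad_inr {r₀ : ZMod p} {β : Gamma0 p} (hb : (β : SL(2, ℤ)) 0 1 = -1) {r : ZMod p}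
    (h : ((((β : SL(2, ℤ)) 1 1 : ℤ) : ZMod p)) = r) (h1 : r ^ (p / 2) = -1)
    (hE : ∀ β β' : Gamma0 p, (β : SL(2, ℤ)) 0 1 = -1 → (β' : SL(2, ℤ)) 0 1 = -1 →
      ((((β : SL(2, ℤ)) 1 1 : ℤ) : ZMod p)) = r → ((((β' : SL(2, ℤ)) 1 1 : ℤ) : ZMod p)) = r₀ → χ β = χ β') :
    (((((β : SL(2, ℤ)) 1 1 : ℤ) : ZMod p)) ^ (p / 2) = 1 ∧ χ β = 0) ∨
    (((((β : SL(2, ℤ)) 1 1 : ℤ) : ZMod p)) ^ (p / 2) = -1 ∧ ∀ β' : Gamma0 p, (β' : SL(2, ℤ)) 0 1 = -1 →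
      ((((β' : SL(2, ℤ)) 1 1 : ℤ) : ZMod p)) = r₀ → χ β = χ β') :=
  Or.inr ⟨by rw [h, h1], fun β' hb' hd' ↦ hE β β' hb hb' h hd'⟩

/-- **Quadratic-`ψ` assembly, element-keyed form.** As `cuspSpanTrace_of_quadratic_certificate`, with the dichotomy stated for
each `b = −1` element `β` instead of each residue. [cite: Pollack2003, Conj. 6.3] -/
theorem cuspSpanTrace_of_quadratic_certificate' (hp2 : p ≠ 2) (h8 : p % 8 = 1)
    (hadd : ∀ γ δ : Gamma0 p, χ (γ * δ) = χ γ + χ δ)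
    (hsmall : ∀ γ : Gamma0 p, ((γ : SL(2, ℤ)) 0 0 + (γ : SL(2, ℤ)) 1 1).natAbs ≤ 2 → χ γ = 0)
    (r₀ : ZMod p) (hr₀ : r₀ ≠ 0)
    (hKE : ∀ β : Gamma0 p, (β : SL(2, ℤ)) 0 1 = -1 →
      (((((β : SL(2, ℤ)) 1 1 : ℤ) : ZMod p)) ^ (p / 2) = 1 ∧ χ β = 0) ∨
      (((((β : SL(2, ℤ)) 1 1 : ℤ) : ZMod p)) ^ (p / 2) = -1 ∧ ∀ β' : Gamma0 p, (β' : SL(2, ℤ)) 0 1 = -1 →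
        ((((β' : SL(2, ℤ)) 1 1 : ℤ) : ZMod p)) = r₀ → χ β = χ β')) :
    ∃ ψ : ZMod p → ZMod 2, (∀ x y : ZMod p, IsUnit x → IsUnit y → ψ (x * y) = ψ x + ψ y) ∧
      ∀ γ : Gamma0 p, χ γ = ψ ((((γ : SL(2, ℤ)) 1 1 : ℤ) : ZMod p)) := by
  refine cuspSpanTrace_of_quadratic_certificate hp2 h8 hadd hsmall r₀ hr₀ fun r hr ↦ ?_
  obtain ⟨β₁, hb₁, hd₁⟩ := exists_b_neg_one_of_isUnit (N := p) (isUnit_iff_ne_zero.mpr hr)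
  rcases hKE β₁ hb₁ with ⟨h1, hK⟩ | ⟨h1, hE⟩
  · rw [hd₁] at h1
    refine Or.inl ⟨h1, fun β hb hd ↦ ?_⟩
    rw [chi_eq_of_apply_zero_one_eq_neg_one hadd hsmall hb hb₁ (by rw [hd, hd₁]), hK]
  · rw [hd₁] at h1
    refine Or.inr ⟨h1, fun β β' hb hb' hd hd' ↦ ?_⟩
    rw [chi_eq_of_apply_zero_one_eq_neg_one hadd hsmall hb hb₁ (by rw [hd, hd₁]), hE β' hb' hd']

section NoInstance

variable {p : ℕ} {χ : Gamma0 p → ZMod 2}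

/-- `quad_inl` without the (unused) primality instance, for the generated certificate terms. [folklore] -/
theorem quad_inl₀ {r₀ : ZMod p} {β : Gamma0 p} (hb : (β : SL(2, ℤ)) 0 1 = -1) {r : ZMod p}
    (h : ((((β : SL(2, ℤ)) 1 1 : ℤ) : ZMod p)) = r) (h1 : r ^ (p / 2) = 1)
    (hK : ∀ β : Gamma0 p, (β : SL(2, ℤ)) 0 1 = -1 → ((((β : SL(2, ℤ)) 1 1 : ℤ) : ZMod p)) = r → χ β = 0) :
    (((((β : SL(2, ℤ)) 1 1 : ℤ) : ZMod p)) ^ (p / 2) = 1 ∧ χ β = 0) ∨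
    (((((β : SL(2, ℤ)) 1 1 : ℤ) : ZMod p)) ^ (p / 2) = -1 ∧ ∀ β' : Gamma0 p, (β' : SL(2, ℤ)) 0 1 = -1 →
      ((((β' : SL(2, ℤ)) 1 1 : ℤ) : ZMod p)) = r₀ → χ β = χ β') :=
  Or.inl ⟨by rw [h, h1], hK β hb h⟩

/-- `quad_inr` without the (unused) primality instance, for the generated certificate terms. [folklore] -/
theorem quad_inr₀ {r₀ : ZMod p} {β : Gamma0 p} (hb : (β : SL(2, ℤ)) 0 1 = -1) {r : ZMod p}
    (h : ((((β : SL(2, ℤ)) 1 1 : ℤ) : ZMod p)) = r) (h1 : r ^ (p / 2) = -1)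
    (hE : ∀ β β' : Gamma0 p, (β : SL(2, ℤ)) 0 1 = -1 → (β' : SL(2, ℤ)) 0 1 = -1 →
      ((((β : SL(2, ℤ)) 1 1 : ℤ) : ZMod p)) = r → ((((β' : SL(2, ℤ)) 1 1 : ℤ) : ZMod p)) = r₀ → χ β = χ β') :
    (((((β : SL(2, ℤ)) 1 1 : ℤ) : ZMod p)) ^ (p / 2) = 1 ∧ χ β = 0) ∨
    (((((β : SL(2, ℤ)) 1 1 : ℤ) : ZMod p)) ^ (p / 2) = -1 ∧ ∀ β' : Gamma0 p, (β' : SL(2, ℤ)) 0 1 = -1 →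
      ((((β' : SL(2, ℤ)) 1 1 : ℤ) : ZMod p)) = r₀ → χ β = χ β') :=
  Or.inr ⟨by rw [h, h1], fun β' hb' hd' ↦ hE β β' hb hb' h hd'⟩

end NoInstance

section SqrtWitness

variable {p : ℕ} {χ : Gamma0 p → ZMod 2}

/-- Dispatch term, square branch with an explicit square root `x` (`x·x = r`): cheap to check. [folklore] -/
theorem quad_inl₁ {r₀ : ZMod p} {β : Gamma0 p} (hb : (β : SL(2, ℤ)) 0 1 = -1) {r : ZMod p}
    (h : ((((β : SL(2, ℤ)) 1 1 : ℤ) : ZMod p)) = r) (x : ZMod p) (hx : x * x = r)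
    (hK : ∀ β : Gamma0 p, (β : SL(2, ℤ)) 0 1 = -1 → ((((β : SL(2, ℤ)) 1 1 : ℤ) : ZMod p)) = r → χ β = 0) :
    (∃ x : ZMod p, x * x = ((((β : SL(2, ℤ)) 1 1 : ℤ) : ZMod p)) ∧ χ β = 0) ∨
    (∃ x : ZMod p, x * x * r₀ = ((((β : SL(2, ℤ)) 1 1 : ℤ) : ZMod p)) ∧ ∀ β' : Gamma0 p, (β' : SL(2, ℤ)) 0 1 = -1 →
      ((((β' : SL(2, ℤ)) 1 1 : ℤ) : ZMod p)) = r₀ → χ β = χ β') :=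
  Or.inl ⟨x, by rw [h, hx], hK β hb h⟩

/-- Dispatch term, non-square branch with an explicit `x` (`x·x·r₀ = r`). [folklore] -/
theorem quad_inr₁ {r₀ : ZMod p} {β : Gamma0 p} (hb : (β : SL(2, ℤ)) 0 1 = -1) {r : ZMod p}
    (h : ((((β : SL(2, ℤ)) 1 1 : ℤ) : ZMod p)) = r) (x : ZMod p) (hx : x * x * r₀ = r)
    (hE : ∀ β β' : Gamma0 p, (β : SL(2, ℤ)) 0 1 = -1 → (β' : SL(2, ℤ)) 0 1 = -1 →
      ((((β : SL(2, ℤ)) 1 1 : ℤ) : ZMod p)) = r → ((((β' : SL(2, ℤ)) 1 1 : ℤ) : ZMod p)) = r₀ → χ β = χ β') :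
    (∃ x : ZMod p, x * x = ((((β : SL(2, ℤ)) 1 1 : ℤ) : ZMod p)) ∧ χ β = 0) ∨
    (∃ x : ZMod p, x * x * r₀ = ((((β : SL(2, ℤ)) 1 1 : ℤ) : ZMod p)) ∧ ∀ β' : Gamma0 p, (β' : SL(2, ℤ)) 0 1 = -1 →
      ((((β' : SL(2, ℤ)) 1 1 : ℤ) : ZMod p)) = r₀ → χ β = χ β') :=
  Or.inr ⟨x, by rw [h, hx], fun β' hb' hd' ↦ hE β β' hb hb' h hd'⟩

end SqrtWitness

section SqrtAssembly

variable {p : ℕ} [Fact p.Prime] {χ : Gamma0 p → ZMod 2}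

/-- **Quadratic-`ψ` assembly, square-root-witness form** (the certificate supplies `x` with `x² = d(β)` or `x² r₀ = d(β)`;
Euler's criterion is applied once here: `r₀^{(p−1)/2} = −1` is the only power checked). [cite: Pollack2003, Conj. 6.3] -/
theorem cuspSpanTrace_of_quadratic_certificate'' (hp2 : p ≠ 2) (h8 : p % 8 = 1)
    (hadd : ∀ γ δ : Gamma0 p, χ (γ * δ) = χ γ + χ δ)
    (hsmall : ∀ γ : Gamma0 p, ((γ : SL(2, ℤ)) 0 0 + (γ : SL(2, ℤ)) 1 1).natAbs ≤ 2 → χ γ = 0)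
    (r₀ : ZMod p) (hr₀ : r₀ ^ (p / 2) = -1)
    (hKE : ∀ β : Gamma0 p, (β : SL(2, ℤ)) 0 1 = -1 →
      (∃ x : ZMod p, x * x = ((((β : SL(2, ℤ)) 1 1 : ℤ) : ZMod p)) ∧ χ β = 0) ∨
      (∃ x : ZMod p, x * x * r₀ = ((((β : SL(2, ℤ)) 1 1 : ℤ) : ZMod p)) ∧ ∀ β' : Gamma0 p, (β' : SL(2, ℤ)) 0 1 = -1 →
        ((((β' : SL(2, ℤ)) 1 1 : ℤ) : ZMod p)) = r₀ → χ β = χ β')) :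
    ∃ ψ : ZMod p → ZMod 2, (∀ x y : ZMod p, IsUnit x → IsUnit y → ψ (x * y) = ψ x + ψ y) ∧
      ∀ γ : Gamma0 p, χ γ = ψ ((((γ : SL(2, ℤ)) 1 1 : ℤ) : ZMod p)) := by
  have hp : p.Prime := Fact.out
  have hr₀0 : r₀ ≠ 0 := by
    intro h0; rw [h0, zero_pow (by have := hp.two_le; omega)] at hr₀
    exact one_ne_zero (neg_eq_zero.mp hr₀.symm)
  have hhalf : p / 2 * 2 = p - 1 := by
    rcases hp.eq_two_or_odd with h | h
    · exact absurd h hp2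
    · omega
  have hsqpow : ∀ x : ZMod p, x ≠ 0 → (x * x) ^ (p / 2) = 1 := by
    intro x hx
    rw [← sq, ← pow_mul, mul_comm, hhalf]
    exact ZMod.pow_card_sub_one_eq_one hx
  refine cuspSpanTrace_of_quadratic_certificate' hp2 h8 hadd hsmall r₀ hr₀0 fun β hb ↦ ?_
  have hne := (isUnit_gamma0_apply_one_one β).ne_zero
  rcases hKE β hb with ⟨x, hx, hK⟩ | ⟨x, hx, hE⟩
  · have hx0 : x ≠ 0 := by rintro rfl; rw [zero_mul] at hx; exact hne hx.symm
    exact Or.inl ⟨by rw [← hx, hsqpow x hx0], hK⟩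
  · have hx0 : x ≠ 0 := by rintro rfl; rw [zero_mul, zero_mul] at hx; exact hne hx.symm
    exact Or.inr ⟨by rw [← hx, mul_pow, hsqpow x hx0, one_mul, hr₀], hE⟩

end SqrtAssembly

end Summit.BirchSwinnertonDyer.BirchSwinnertonDyer.Theorems.SignedMuAtTwo
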